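import Summits.ValiantsHypothesis.ValiantsHypothesis.Theses.SOSTau
import Literature.Computability.AlgebraicComplexity.TavenasVnWitness
import Literature.Computability.AlgebraicComplexity.SetMultilinear
import Literature.Computability.AlgebraicComplexity.SOSDecompositionProofs
import Literature.Computability.AlgebraicComplexity.ValiantClasses
import Summits.ValiantsHypothesis.ValiantsHypothesis.Theorems.FeketeSOSSOSMagnificationStubPolarisedSOS
import Summits.ValiantsHypothesis.ValiantsHypothesis.Theorems.FeketeSOSSOSMagnificationStubDigitKronecker
import Summits.ValiantsHypothesis.ValiantsHypothesis.Theorems.FeketeSOSSOSMagnificationStubVnpAssembly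

/-!
# Line `SketchWitness` — crux `SOSTau.HutchinsonMagnification` (stmt-ValiantsHypothesis-18749): LEAD SKELETON

Lead prover prover-line-stmt-ValiantsHypothesis-18749-0, 2026-08-17.  This is the strategist's registered
composition `hex-bilinear-transport` (planner-cstrat-…-b1-0: VSBR middle cut `exists_bilin_of_two_le_totalDegree`
+ landed `stub_polarisedSOS` + landed `dk_partA` + bundling `mem_VNP/VP_ofFintype_iff_holds`) with its V-half
(old stubs V1 `stub_hexBilinearExponent` + V2 `stub_vnpHexLift`) REPLACED by ONE def-free witness stub in the
exact shape consumed by the landed level-wise `VNP` assembly `isVNPFamily_of_levelwise'` (idea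
`definability-projection`, planner-cruxidea-…-2-0: the Boolean-sum witness is the transcript polynomial of Tavenas'
LANDED exponent circuit `TavenasVn.vCirc (4m)` times a hex selector and a magnitude selector; no new circuit,
no bilinear-exponent identity).  Every stub below has a complete, farm-checked proof in
`Cruxes/HutchinsonMagnification/HutchinsonMagnificationCandidate.lean` (rc 0, 0 sorries, standard axioms); the
stubs are landed one file each under `Theorems/SOSTauHutchinsonMagnification*.lean` and this composition, with
the stubs imported, is the closing file `Theorems/SOSTauHutchinsonMagnification.lean`.

Stubs (the ONLY sorries of this file):
* W  `stub_hexLiftWitness` — level-wise Def. 2.5 witness for the hex digit lift of `V_{4m}`: Boolean length,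
     complexity and degree all `≤ 60·vExpSize(4m) + 300(m+1)` (hardest; held by the lead).
* T2 `stub_kroneckerHex` — set-multilinearity, exact degree `m`, Kronecker faithfulness onto `V_{4m}` (verbatim
     the strategist's T2).
* T3 `stub_hexBudget` — quasi-polynomial · `8^m` eventually below `η · 16^m` (verbatim the strategist's T3).
* R  `stub_complexToReal` — the route's support item `ComplexToRealSOS` (stmt-ValiantsHypothesis-18750) BY NAME
     (verbatim the strategist's R; Dutta 2021 Lemma 10).

Composition (PROVED, sorry-free): `vnpHexLift_of : W → IsVNPFamily (hex lift)`,
`collapse_of : W → T2 → T3 → SOSTau.CollapseCheapComplexSOS` (support item stmt-ValiantsHypothesis-18751 by name),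
`HutchinsonMagnification_of : W → T2 → T3 → R → SOSTau.HutchinsonMagnification` (the crux BY NAME).

Disproof.lean: none published for this crux at the time of writing (`Cruxes/HutchinsonMagnification/Disproof.lean`
absent; payload path not mounted); the refuter's crux-attack (rattack-18749) records "not refutable short of ¬VH ∧ A".
-/

set_option linter.dupNamespace false

noncomputable section

open MvPolynomial Finset
open Literature.Computability.AlgebraicComplexity
open Summit.ValiantsHypothesis.ValiantsHypothesis.Theorems.FeketeSOSSOSMagnification
  (stub_polarisedSOS dk_partA isVNPFamily_of_levelwise')

namespace Summit.ValiantsHypothesis.ValiantsHypothesis.Cruxes.HutchinsonMagnification.SketchWitness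

/-! ## Stub statements: the precise `Prop`s (the registered stubs below restate them verbatim, def-free)

Throughout, the level-`m` hex digit lift of `V_{4m}` is written out in full:
`P_m = Σ_{i < 16^m} C (2^{vExp (4m) i}) · Π_{j<m} y_{(j, i / 16^j % 16)} ∈ ℂ[y_{(j,h)} : j < m, h < 16]`,
and the level-wise cost bound is `β(m) = 60 · vExpSize (4m) + 300 (m + 1)` (`TavenasVn.vExpSize` = the size
bound of Tavenas' exponent circuit `vCirc`). -/

/-- **W (the transcript witness, size L).** For every level `m` there are a Boolean length `r` and a polynomial
`g` in the genuine variables `Fin m × Fin 16` plus `r` Boolean variables whose Valiant Boolean sum is the hex digit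
lift `P_m`, with `r`, `complexity g` and `deg g` all `≤ β(m)`.  Why true: take `r = 4m + |vCirc (4m)|` and
`g = VALID(vCirc (4m))(b, y) · Π_j (Σ_h X_{(j,h)} Π_{r<4} lit(bit_r h)(b_{4j+r})) · Π_l (1 + (2^{2^l} − 1)·wire_l(b, y))`:
at a Boolean point `(b, y)` the transcript factor kills every `y` but the true transcript, where the output wires
carry the bits of `vExp (4m) (ofBits b)` (`bwval_trueTranscript_vOut`, `sum_C_eval_validPoly_mul`), the hex
selector is the one-hot monomial of the digits of `b` and the last factor is `2^{vExp}`; reindex `b ↔ i < 16^m`.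
Costs from `complexity_consPoly_le`, `complexity_wirePoly`, `complexity_finset_prod_le`, `size_vCirc_le`. -/
def Stmt.stub_hexLiftWitness : Prop :=
  ∀ m : ℕ, ∃ (r : ℕ) (g : MvPolynomial ((Fin m × Fin 16) ⊕ Fin r) ℂ),
    boolSum g = ∑ i ∈ Finset.range (16 ^ m), C ((2 : ℂ) ^ vExp (4 * m) i) *
        ∏ j : Fin m, X (j, (⟨i / 16 ^ (j : ℕ) % 16, Nat.mod_lt _ (by norm_num)⟩ : Fin 16)) ∧
    r ≤ 60 * TavenasVn.vExpSize (4 * m) + 300 * (m + 1) ∧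
    complexity g ≤ 60 * TavenasVn.vExpSize (4 * m) + 300 * (m + 1) ∧
    g.totalDegree ≤ 60 * TavenasVn.vExpSize (4 * m) + 300 * (m + 1)

/-- **T2 (hex digit lift ⟷ inverse Kronecker substitution, size M).** `P_m` is set-multilinear over the `m`
digit blocks, has total degree exactly `m`, and `κ : y_{(j,h)} ↦ X^{h·16^j}` maps it to `V_{4m}` over `ℂ`.
Leans on the landed generic lemmas `dk_isSetMultilinear_lift`, `dk_totalDegree_lift`, `dk_aeval_lift`,
`dk_sum_digit_mul_pow`, then `16^m = 2^{4m}` and `map_tavenasV'`. -/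
def Stmt.stub_kroneckerHex : Prop :=
  ∀ m : ℕ,
    IsSetMultilinear (Prod.fst : Fin m × Fin 16 → Fin m) Finset.univ
      (∑ i ∈ Finset.range (16 ^ m), C ((2 : ℂ) ^ vExp (4 * m) i) *
        ∏ j : Fin m, X (j, (⟨i / 16 ^ (j : ℕ) % 16, Nat.mod_lt _ (by norm_num)⟩ : Fin 16)) :
          MvPolynomial (Fin m × Fin 16) ℂ) ∧
    (∑ i ∈ Finset.range (16 ^ m), C ((2 : ℂ) ^ vExp (4 * m) i) *
        ∏ j : Fin m, X (j, (⟨i / 16 ^ (j : ℕ) % 16, Nat.mod_lt _ (by norm_num)⟩ : Fin 16)) :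
          MvPolynomial (Fin m × Fin 16) ℂ).totalDegree = m ∧
    MvPolynomial.aeval (fun v : Fin m × Fin 16 => (Polynomial.X : Polynomial ℂ) ^ ((v.2 : ℕ) * 16 ^ (v.1 : ℕ)))
        (∑ i ∈ Finset.range (16 ^ m), C ((2 : ℂ) ^ vExp (4 * m) i) *
        ∏ j : Fin m, X (j, (⟨i / 16 ^ (j : ℕ) % 16, Nat.mod_lt _ (by norm_num)⟩ : Fin 16)) :
            MvPolynomial (Fin m × Fin 16) ℂ) =
      (tavenasV (4 * m)).map (Int.castRingHom ℂ)

/-- **T3 (the linear-threshold budget at radix 16, size M).** For every `c` and `η > 0`, eventually in `m`: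
for all `L ≤ m^c + c`, `2^{m+1} · T · (16^{⌊m/2⌋} + 16^{m−⌊m/2⌋}) < η · 2^{4m}` with
`T = (m+1)·((4L(m+1)²)·(4L(m+1)²))^{⌊log₂ m⌋}` (quasi-polynomial · `8^m` against `16^m`). -/
def Stmt.stub_hexBudget : Prop :=
  ∀ (c : ℕ) (η : ℝ), 0 < η → ∃ m₀ : ℕ, ∀ m : ℕ, m₀ ≤ m → ∀ L : ℕ, L ≤ m ^ c + c →
    ((2 ^ (m + 1) * ((m + 1) * ((4 * L * (m + 1) ^ 2) * (4 * L * (m + 1) ^ 2)) ^ Nat.log 2 m) *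
        (16 ^ (m / 2) + 16 ^ (m - m / 2)) : ℕ) : ℝ) < η * 2 ^ (4 * m)

/-! ## Registered stubs (the ONLY sorries of this file) -/

/-- stub W = `Stmt.stub_hexLiftWitness` (level-wise Def. 2.5 witness for the hex digit lift, costs `≤ β(m)`). -/
theorem stub_hexLiftWitness :
    ∀ m : ℕ, ∃ (r : ℕ) (g : MvPolynomial ((Fin m × Fin 16) ⊕ Fin r) ℂ),
      boolSum g = ∑ i ∈ Finset.range (16 ^ m), C ((2 : ℂ) ^ vExp (4 * m) i) *
        ∏ j : Fin m, X (j, (⟨i / 16 ^ (j : ℕ) % 16, Nat.mod_lt _ (by norm_num)⟩ : Fin 16)) ∧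
      r ≤ 60 * TavenasVn.vExpSize (4 * m) + 300 * (m + 1) ∧
      complexity g ≤ 60 * TavenasVn.vExpSize (4 * m) + 300 * (m + 1) ∧
      g.totalDegree ≤ 60 * TavenasVn.vExpSize (4 * m) + 300 * (m + 1) := by
  sorry

/-- stub T2 = `Stmt.stub_kroneckerHex` (set-multilinearity, exact degree `m`, Kronecker faithfulness onto `V_{4m}`). -/
theorem stub_kroneckerHex :
    ∀ m : ℕ,
      IsSetMultilinear (Prod.fst : Fin m × Fin 16 → Fin m) Finset.univ
        (∑ i ∈ Finset.range (16 ^ m), C ((2 : ℂ) ^ vExp (4 * m) i) *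
        ∏ j : Fin m, X (j, (⟨i / 16 ^ (j : ℕ) % 16, Nat.mod_lt _ (by norm_num)⟩ : Fin 16)) :
            MvPolynomial (Fin m × Fin 16) ℂ) ∧
      (∑ i ∈ Finset.range (16 ^ m), C ((2 : ℂ) ^ vExp (4 * m) i) *
        ∏ j : Fin m, X (j, (⟨i / 16 ^ (j : ℕ) % 16, Nat.mod_lt _ (by norm_num)⟩ : Fin 16)) :
            MvPolynomial (Fin m × Fin 16) ℂ).totalDegree = m ∧
      MvPolynomial.aeval (fun v : Fin m × Fin 16 => (Polynomial.X : Polynomial ℂ) ^ ((v.2 : ℕ) * 16 ^ (v.1 : ℕ)))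
          (∑ i ∈ Finset.range (16 ^ m), C ((2 : ℂ) ^ vExp (4 * m) i) *
        ∏ j : Fin m, X (j, (⟨i / 16 ^ (j : ℕ) % 16, Nat.mod_lt _ (by norm_num)⟩ : Fin 16)) :
              MvPolynomial (Fin m × Fin 16) ℂ) =
        (tavenasV (4 * m)).map (Int.castRingHom ℂ) := by
  sorry

/-- stub T3 = `Stmt.stub_hexBudget` (quasi-polynomial · 8^m is eventually below η · 16^m). -/
theorem stub_hexBudget :
    ∀ (c : ℕ) (η : ℝ), 0 < η → ∃ m₀ : ℕ, ∀ m : ℕ, m₀ ≤ m → ∀ L : ℕ, L ≤ m ^ c + c →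
      ((2 ^ (m + 1) * ((m + 1) * ((4 * L * (m + 1) ^ 2) * (4 * L * (m + 1) ^ 2)) ^ Nat.log 2 m) *
          (16 ^ (m / 2) + 16 ^ (m - m / 2)) : ℕ) : ℝ) < η * 2 ^ (4 * m) := by
  sorry

/-- stub R = the route's support item `ComplexToRealSOS` (stmt-ValiantsHypothesis-18750; Dutta 2021 Lemma 10:
`Re(a g²) = (α+β)u² + (β−α)v² − β(u+v)²`, all three squares supported inside `supp g`), BY NAME. -/
theorem stub_complexToReal :
    Summit.ValiantsHypothesis.ValiantsHypothesis.Theses.SOSTau.ComplexToRealSOS := by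
  sorry

/-! ## Composition, part 0 (PROVED): W ⇒ the hex digit lift family is in `VNP_ℂ` (Bürgisser Def. 2.5) -/

/-- The hex digit lift is a p-family: `16 m` variables, degree `≤ m`. -/
theorem isPFamily_hexLift :
    @IsPFamily ℂ _ (fun m => Fin m × Fin 16) _
      (fun m => ∑ i ∈ Finset.range (16 ^ m), C ((2 : ℂ) ^ vExp (4 * m) i) *
        ∏ j : Fin m, X (j, (⟨i / 16 ^ (j : ℕ) % 16, Nat.mod_lt _ (by norm_num)⟩ : Fin 16))) := by
  refine ⟨?_, IsPBounded.mono IsPBounded.id fun m => ?_⟩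
  · refine IsPBounded.mono (IsPBounded.mul_holds (IsPBounded.const 16) IsPBounded.id) fun m => ?_
    simp [mul_comm]
  · refine totalDegree_finsetSum_le fun i _ => ?_
    refine (totalDegree_mul _ _).trans ?_
    rw [totalDegree_C, zero_add]
    refine (totalDegree_finsetProd _ _).trans ?_
    calc ∑ j : Fin m, (X (j, (⟨i / 16 ^ (j : ℕ) % 16, Nat.mod_lt _ (by norm_num)⟩ : Fin 16)) :
            MvPolynomial (Fin m × Fin 16) ℂ).totalDegree ≤ ∑ _j : Fin m, 1 :=
          Finset.sum_le_sum fun j _ => CircuitArith.totalDegree_X_le_one' (k := ℂ) _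
      _ = m := by simp

/-- Tavenas' exponent circuit is polynomial-size in the level, hence so is the cost bound `β`. -/
theorem isPBounded_hexBound : IsPBounded fun m : ℕ => 60 * TavenasVn.vExpSize (4 * m) + 300 * (m + 1) := by
  have c := fun k : ℕ => IsPBounded.const k
  have h4 : IsPBounded (fun m : ℕ => 4 * m) := IsPBounded.mul_holds (c 4) IsPBounded.id
  have hstep : IsPBounded (fun m : ℕ => Literature.Computability.Complexity.ArithCkt.mulStepSize (4 * m)) := by
    unfold Literature.Computability.Complexity.ArithCkt.mulStepSize
      Literature.Computability.Complexity.ArithCkt.addSize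
    exact IsPBounded.add_holds (IsPBounded.add_holds h4 h4)
      (IsPBounded.add_holds (IsPBounded.mul_holds (c 73) (IsPBounded.add_holds h4 h4)) (c 1))
  have hsz : IsPBounded fun m : ℕ => TavenasVn.vExpSize (4 * m) := by
    unfold TavenasVn.vExpSize
    exact IsPBounded.add_holds (IsPBounded.add_holds h4
      (IsPBounded.add_holds (IsPBounded.mul_holds h4 hstep) (c 1))) (c 1)
  exact IsPBounded.add_holds (IsPBounded.mul_holds (c 60) hsz)
    (IsPBounded.mul_holds (c 300) (IsPBounded.add_holds IsPBounded.id (c 1)))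

/-- **W ⇒ the hex digit lift family of `V_{4m}` is a `VNP` family over `ℂ`** (level-wise Def. 2.5 assembly,
landed `isVNPFamily_of_levelwise'`). -/
theorem vnpHexLift_of (hW : Stmt.stub_hexLiftWitness) :
    @IsVNPFamily ℂ _ (fun m => Fin m × Fin 16) _
      (fun m => ∑ i ∈ Finset.range (16 ^ m), C ((2 : ℂ) ^ vExp (4 * m) i) *
        ∏ j : Fin m, X (j, (⟨i / 16 ^ (j : ℕ) % 16, Nat.mod_lt _ (by norm_num)⟩ : Fin 16))) :=
  isVNPFamily_of_levelwise' isPFamily_hexLift isPBounded_hexBound hW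

/-! ## Composition, part 1 (PROVED): W + T2 + T3 ⇒ support item `CollapseCheapComplexSOS` BY NAME -/

/-- **Cheap complex SOS under the collapse.** `VP_ℂ = VNP_ℂ ⇒` for every `η > 0`, at every level `n = 4m` with
`m` large, `V_n` has a complex weighted SOS representation of support-sum `< η·2^n`: the transferred
Dutta–Saxena–Thierauf chain (VNP-membership of the hex lift, VSBR middle cut, polarised set-multilinear
projection, inverse Kronecker substitution, budget).  Sorry-free given the three stub statements. -/
theorem collapse_of (hW : Stmt.stub_hexLiftWitness) (hDK : Stmt.stub_kroneckerHex) (hBud : Stmt.stub_hexBudget) :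
    Summit.ValiantsHypothesis.ValiantsHypothesis.Theses.SOSTau.CollapseCheapComplexSOS := by
  classical
  intro hEq η hη n₀
  -- (1) the hex lift family is in VNP (transcript witness), hence in VP under the collapse: an exponent `c`
  have h1 := vnpHexLift_of hW
  have hVP : @IsVPFamily ℂ _ (fun m => Fin m × Fin 16) _
      (fun m => ∑ i ∈ Finset.range (16 ^ m), C ((2 : ℂ) ^ vExp (4 * m) i) *
        ∏ j : Fin m, X (j, (⟨i / 16 ^ (j : ℕ) % 16, Nat.mod_lt _ (by norm_num)⟩ : Fin 16))) := by
    have hmem := (mem_VNP_ofFintype_iff_holds (k := ℂ) (σ := fun m => Fin m × Fin 16) _).2 h1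
    rw [← hEq] at hmem
    exact (mem_VP_ofFintype_iff_holds (k := ℂ) (σ := fun m => Fin m × Fin 16) _).1 hmem
  obtain ⟨c, hc⟩ := hVP.2
  -- (2) the budget threshold and a large level `m`
  obtain ⟨m₀, hm₀⟩ := hBud c η hη
  obtain ⟨m, hm₀m, hn₀m, h2m⟩ : ∃ m, m₀ ≤ m ∧ n₀ ≤ m ∧ 2 ≤ m :=
    ⟨max (max m₀ n₀) 2, le_trans (le_max_left _ _) (le_max_left _ _),
      le_trans (le_max_right _ _) (le_max_left _ _), le_max_right _ _⟩
  refine ⟨4 * m, by omega, ?_⟩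
  -- the level-`m` lift `P` and the inverse Kronecker substitution `κ`
  set P : MvPolynomial (Fin m × Fin 16) ℂ :=
    ∑ i ∈ Finset.range (16 ^ m), C ((2 : ℂ) ^ vExp (4 * m) i) *
      ∏ j : Fin m, X (j, (⟨i / 16 ^ (j : ℕ) % 16, Nat.mod_lt _ (by norm_num)⟩ : Fin 16)) with hPdef
  set κ : Fin m × Fin 16 → Polynomial ℂ :=
    fun v => (Polynomial.X : Polynomial ℂ) ^ ((v.2 : ℕ) * 16 ^ (v.1 : ℕ)) with hκdef
  have hcm : complexity P ≤ m ^ c + c := hc m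
  have hB := hm₀ m hm₀m (complexity P) hcm
  -- (3) lift facts (T2): set-multilinear, total degree `m`, `κ P = V_{4m}`
  obtain ⟨hsml, hdeg, hfaith⟩ := hDK m
  -- (4) the bilinear middle cut at `j = m / 2` (tree: DST24 Lemma 3.1, steps 1–4)
  have h2deg : 2 ≤ P.totalDegree := by rw [hdeg]; exact h2m
  obtain ⟨-, Lst, hLlen, hLdeg, hLsum⟩ := exists_bilin_of_two_le_totalDegree P h2deg (m / 2)
  rw [hdeg] at hLlen hLdeg
  set t := Lst.length with ht
  have hPsum : P = ∑ i : Fin t, (Lst[(i : ℕ)]).1 * (Lst[(i : ℕ)]).2 := by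
    rw [Fin.sum_univ_fun_getElem Lst fun gh => gh.1 * gh.2]
    exact hLsum.symm
  have hgdeg : ∀ i : Fin t, (Lst[(i : ℕ)]).1.totalDegree ≤ m / 2 := fun i =>
    (hLdeg _ (List.getElem_mem i.2)).1
  have hhdeg : ∀ i : Fin t, (Lst[(i : ℕ)]).2.totalDegree ≤ m - m / 2 := fun i =>
    (hLdeg _ (List.getElem_mem i.2)).2
  -- (5) set-multilinear projection + polarisation (tree: `stub_polarisedSOS`, radix 16)
  obtain ⟨s, a, q, hs, hrep, hsupp, hbsm⟩ :=
    stub_polarisedSOS m 16 t (m / 2) (m - m / 2) P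
      (fun i => (Lst[(i : ℕ)]).1) (fun i => (Lst[(i : ℕ)]).2) (by norm_num) hsml hPsum hgdeg hhdeg
  -- (6) Kronecker transport of the identity and of the supports (tree: `dk_partA`)
  have hGrep : (∑ i, Polynomial.C (a i) * (MvPolynomial.aeval κ (q i)) ^ 2) =
      (tavenasV (4 * m)).map (Int.castRingHom ℂ) := by
    have h := congrArg (MvPolynomial.aeval κ) hrep
    rw [hfaith, map_sum] at h
    simp only [map_mul, map_pow, MvPolynomial.aeval_C, Polynomial.algebraMap_eq] at h
    exact h.symm
  have hGsupp : ∀ i, (MvPolynomial.aeval κ (q i)).support.card ≤ 16 ^ (m / 2) + 16 ^ (m - m / 2) :=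
    fun i => ((dk_partA m 16 (q i) (hbsm i)).1).trans (hsupp i)
  refine ⟨s, a, fun i => MvPolynomial.aeval κ (q i), hGrep, ?_⟩
  -- (7) the support-sum count against the budget
  have hsT : s ≤ 2 ^ (m + 1) * ((m + 1) * ((4 * complexity P * (m + 1) ^ 2) *
      (4 * complexity P * (m + 1) ^ 2)) ^ Nat.log 2 m) :=
    hs.trans (Nat.mul_le_mul_left _ hLlen)
  have hsum : (∑ i, ((MvPolynomial.aeval κ (q i)).support.card : ℝ)) ≤
      ((2 ^ (m + 1) * ((m + 1) * ((4 * complexity P * (m + 1) ^ 2) *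
        (4 * complexity P * (m + 1) ^ 2)) ^ Nat.log 2 m) *
        (16 ^ (m / 2) + 16 ^ (m - m / 2)) : ℕ) : ℝ) := by
    calc (∑ i, ((MvPolynomial.aeval κ (q i)).support.card : ℝ))
        ≤ ∑ _i : Fin s, ((16 ^ (m / 2) + 16 ^ (m - m / 2) : ℕ) : ℝ) :=
          Finset.sum_le_sum fun i _ => by exact_mod_cast hGsupp i
      _ = (s : ℝ) * ((16 ^ (m / 2) + 16 ^ (m - m / 2) : ℕ) : ℝ) := by
          rw [Finset.sum_const, Finset.card_univ, Fintype.card_fin, nsmul_eq_mul]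
      _ ≤ _ := by exact_mod_cast Nat.mul_le_mul_right _ hsT
  exact lt_of_le_of_lt hsum hB

/-! ## Composition, part 2 (PROVED): the four stubs imply the crux BY NAME -/

/-- **The line.** `W → T2 → T3 → R → HutchinsonMagnification`: assume linear real sparse-SOS hardness of
`V_n` with data `(η, n₀)` and, for contradiction, `VP_ℂ = VNP_ℂ`; `collapse_of` at `η/4` yields a level
`n = 4m ≥ n₀` and a complex representation of `V_n` of support-sum `< (η/4)·2^n`; realify it (R, support ×4,
`((V_n)_ℝ)_ℂ = (V_n)_ℂ` by `Polynomial.map_map`) and feed it to the hardness hypothesis: `η 2^n ≤ 4·(<η/4·2^n)`,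
absurd.  Sorry-free. -/
theorem HutchinsonMagnification_of (hW : Stmt.stub_hexLiftWitness) (hDK : Stmt.stub_kroneckerHex) (hBud : Stmt.stub_hexBudget)
    (hCR : Summit.ValiantsHypothesis.ValiantsHypothesis.Theses.SOSTau.ComplexToRealSOS) :
    Summit.ValiantsHypothesis.ValiantsHypothesis.Theses.SOSTau.HutchinsonMagnification := by
  classical
  have hCol := collapse_of hW hDK hBud
  rintro ⟨η, hη, n₀, H⟩
  show Literature.Computability.AlgebraicComplexity.VP ℂ ≠
    Literature.Computability.AlgebraicComplexity.VNP ℂ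
  intro hEq
  obtain ⟨n, hn, s, a, g, hrep, hlt⟩ := hCol hEq (η / 4) (by positivity) n₀
  have hrep' : (∑ i, Polynomial.C (a i) * g i ^ 2) =
      ((tavenasV n).map (Int.castRingHom ℝ)).map (algebraMap ℝ ℂ) := by
    rw [hrep, Polynomial.map_map]
    congr 1
  obtain ⟨s', a', g', hreal, hle⟩ := hCR ((tavenasV n).map (Int.castRingHom ℝ)) s a g hrep'
  have key := H n hn s' a' g' hreal
  have hcast : (∑ i, ((g' i).support.card : ℝ)) ≤ 4 * ∑ i, ((g i).support.card : ℝ) := by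
    have := (Nat.cast_le (α := ℝ)).mpr hle
    push_cast at this
    exact this
  have h2 : (0 : ℝ) < 2 ^ n := by positivity
  linarith

/-- The crux from the registered stubs (typechecks iff the `Stmt.*` texts are the stub signatures verbatim). -/
theorem HutchinsonMagnification_proof :
    Summit.ValiantsHypothesis.ValiantsHypothesis.Theses.SOSTau.HutchinsonMagnification :=
  HutchinsonMagnification_of stub_hexLiftWitness stub_kroneckerHex stub_hexBudget stub_complexToReal

end Summit.ValiantsHypothesis.ValiantsHypothesis.Cruxes.HutchinsonMagnification.SketchWitness

end
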